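import Summits.Langlands.Langlands.Theorems.IrreducibilityBySelfDualityIrreducibleOffSectorOpenRegions
import Summits.Langlands.Langlands.Theorems.IrreducibilityBySelfDualityIrreducibleOffSectorArtinType
import Summits.Langlands.Langlands.Theorems.IrreducibilityBySelfDualityIrreducibleOffSectorMonomialRegion
import HarnessLib

/-!
# `IrreducibleOffSector` from its open regions, v2: the Galois-type and monomial regions carved out
(crux stmt-Langlands-14329 `IrreducibilityBySelfDuality.IrreducibleOffSector`, line `Sketch`;
`--supports` file, STRUCTURAL: no import of the route module; continuation lead c5)

The certified map `irreducibleOffSector_text_of_open_regions` (p118444, lead c2) writes the crux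
text as: printed inputs ∧ Buzzard–Gee 3.1.6(`GL_2`) ∧ four OPEN REGIONS `H3irr` (rank 3, irregular
`π`), `H3esd` (rank 3, `K` neither totally real nor CM, `π` regular and essentially self-dual),
`H4att` (rank `≥ 4`, `K` totally real or CM: irreducibility of the lang.S27 representation of a
regular algebraic `π'`), `H4rest` (rank `≥ 4`, `π` irregular or `K` neither totally real nor CM).
Since then two UNCONDITIONAL regions landed, each valid in every rank over every number field,
for regular and irregular `π` alike:

* the GALOIS-TYPE region (lead c3, p119699 `isIrreducible_of_isPiOfArtinRep`): `π = π(σ)` at almost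
  all places for an irreducible Artin representation `σ` (`IsPiOfArtinRep σ π`) ⇒ every
  a.e.-compatible `ρ` is irreducible;
* the MONOMIAL (CM-type) region (lead c4, p122622
  `isIrreducible_of_isAutomorphicInductionAlong_one_of_isLAlgebraic`): `π` automorphically induced
  (`IsAutomorphicInductionAlong`, Arthur–Clozel Ch. 3 Def. 6.1) from an L-algebraic, Galois-regular
  `GL_1` datum `τ` of a Galois extension `E/K` ⇒ every a.e.-compatible `ρ` is irreducible.

This file re-certifies the map with both regions CARVED OUT of `H3irr`, `H3esd` and `H4rest`: each
of these three open regions now carries the extra antecedents "`π` is not of Galois type" and "`π`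
is not monomial" (`irreducibleOffSector_text_of_open_regions_v2`).  `H4att` is kept verbatim (it is
phrased for the C-normalised representation attached to a regular algebraic `π'`; the Galois-type /
monomial carve-out there would pass through the half-integral twist of `…RegularAttached` and is not
needed: a regular algebraic `π'` of Galois type has finite-image attached representation, and the
monomial regular case is inside lang.S27's own induction-compatible construction).  The dispatch
lemma `conclusion_of_not_galoisType_not_monomial` is the only new logic: case on the two predicates,
apply the landed region theorems, else fall through to the residual open region.

So, modulo printed theorems and BG 3.1.6(`GL_2`), the crux is now equivalent to the conjunction of
`H4att` and the three RESIDUAL regions `H3irr'`, `H3esd'`, `H4rest'` (non-Galois-type, non-monomial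
`π`); these are the fileable children of the node after c3/c4.

References: D. Ramakrishnan, *Irreducibility and cuspidality* (2008), §0; G. Böckle, C.-Y. Hui,
Math. Ann. 393 (2025), Thms. 1.1–1.2; K. Buzzard, T. Gee, LMS LNS 414 (2014), Conj. 3.1.6;
J. Arthur, L. Clozel, Ann. of Math. Stud. 120 (1989), Ch. 3 Def. 6.1; J. Tunnell, Bull. AMS 5 (1981).
-/

noncomputable section

set_option linter.dupNamespace false

open scoped NumberField Classical
open Filter IsDedekindDomain NumberField
open Literature.NumberTheory.Automorphic Literature.NumberTheory.GaloisRepresentations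
open Summit.Langlands

namespace Summit.Langlands.Langlands.Theorems.IrreducibleOffSector

/-! ### The dispatch through the two landed regions -/

/-- **Dispatch: Galois type, monomial, or residual.**  For a cuspidal `π` on `GL_n(𝔸_K)`, `ℓ` and
`ι`: if the crux's conclusion (every a.e.-compatible `ρ` irreducible) is granted for `π` NOT of
Galois type and NOT monomial, then it holds outright — the Galois-type case is
`isIrreducible_of_isPiOfArtinRep` (p119699), the monomial case is
`isIrreducible_of_isAutomorphicInductionAlong_one_of_isLAlgebraic` (p122622).
[cite: BuzzardGeeLMS2014, Conj. 3.2.1] -/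
theorem conclusion_of_not_galoisType_not_monomial {n : ℕ} {K : Type} [Field K] [NumberField K]
    {hcpt : isCompact_glFiniteIntegralLevel n K} (π : CuspidalAutomorphicRepData n K hcpt)
    {ℓ : ℕ} [Fact ℓ.Prime] (ι : PadicAlgCl ℓ ≃+* ℂ)
    (hres : (¬ ∃ σ : FramedArtinRep K n, σ.toGaloisRep.IsIrreducible ∧ IsPiOfArtinRep σ π.1) →
      (¬ ∃ (E : Type) (_ : Field E) (_ : NumberField E) (_ : Algebra K E) (_ : IsGalois K E)
          (h1 : isCompact_glFiniteIntegralLevel 1 E) (τ : AutomorphicRepData (AutomorphyDatum.gl 1 E h1)),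
          τ.IsLAlgebraic ∧ IsAutomorphicInductionAlong τ π.1 ∧
          ∀ g : E ≃ₐ[K] E, g ≠ 1 →
            ¬ ∀ᶠ w : HeightOneSpectrum (𝓞 E) in cofinite, ∀ α : Multiset ℂ,
                τ.HasSatakeParamAt w α → τ.HasSatakeParamAt (g • w) α) →
      ∀ ρ : FramedGaloisRep K (PadicAlgCl ℓ) n,
        (∀ᶠ v : HeightOneSpectrum (𝓞 K) in cofinite, SatakeFrobCompatibleAt ι π.1 ρ v) →
          ρ.toGaloisRep.IsIrreducible)
    (ρ : FramedGaloisRep K (PadicAlgCl ℓ) n)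
    (hρ : ∀ᶠ v : HeightOneSpectrum (𝓞 K) in cofinite, SatakeFrobCompatibleAt ι π.1 ρ v) :
    ρ.toGaloisRep.IsIrreducible := by
  by_cases hG : ∃ σ : FramedArtinRep K n, σ.toGaloisRep.IsIrreducible ∧ IsPiOfArtinRep σ π.1
  · obtain ⟨σ, hσ, hπσ⟩ := hG
    exact isIrreducible_of_isPiOfArtinRep π.1 hσ hπσ ι ρ hρ
  by_cases hM : ∃ (E : Type) (_ : Field E) (_ : NumberField E) (_ : Algebra K E) (_ : IsGalois K E)
      (h1 : isCompact_glFiniteIntegralLevel 1 E) (τ : AutomorphicRepData (AutomorphyDatum.gl 1 E h1)),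
      τ.IsLAlgebraic ∧ IsAutomorphicInductionAlong τ π.1 ∧
      ∀ g : E ≃ₐ[K] E, g ≠ 1 →
        ¬ ∀ᶠ w : HeightOneSpectrum (𝓞 E) in cofinite, ∀ α : Multiset ℂ,
            τ.HasSatakeParamAt w α → τ.HasSatakeParamAt (g • w) α
  · obtain ⟨E, _, _, _, _, h1, τ, hτ, hAI, hreg⟩ := hM
    exact isIrreducible_of_isAutomorphicInductionAlong_one_of_isLAlgebraic ι τ hτ π.1 hAI hreg ρ hρ
  · exact hres hG hM ρ hρ

/-! ### The certified map, v2 -/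

/-- **The crux from its open regions, v2 (Galois-type and monomial regions carved out).**  GIVEN
the printed inputs lang.S27 (`exists_galoisRep_of_regularAlgebraic`), Böckle–Hui Thm. 1.2
(`isIrreducible_galoisRep_gl3_totallyReal`), Böckle–Hui Thm. 1.1 in cofinite `GL(1)` form (text of
`WeakAbelianSummandHecke`), Clozel's Hecke field (`Clozel1990_heckeEigenvalueField`) and Arthur–Clozel
(2.2); the CONJECTURE Buzzard–Gee 3.1.6 for L-algebraic cuspidal `GL_2` (`hLA2`); the open region
`H4att` (rank `≥ 4`, `K` totally real or CM: irreducibility of the representation attached to a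
regular algebraic `π'`) VERBATIM as in v1; and the three RESIDUAL open regions — `H3irr'` (rank 3,
irregular `π`), `H3esd'` (rank 3, `K` neither totally real nor CM, `π` regular and essentially
self-dual), `H4rest'` (rank `≥ 4`, `π` irregular or `K` neither totally real nor CM), each now ONLY
for `π` that is neither of Galois type (`¬ ∃ σ` irreducible Artin with `IsPiOfArtinRep σ π`) nor
monomial (`¬ ∃` an L-algebraic Galois-regular `GL_1` datum `τ` of a Galois `E/K` with
`IsAutomorphicInductionAlong τ π`) — the text of `IrreducibleOffSector` holds verbatim.  Proof: the
v1 map `irreducibleOffSector_text_of_open_regions` (p118444) fed, in each of the three regions, with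
the dispatch `conclusion_of_not_galoisType_not_monomial` through the landed Galois-type (p119699) and
monomial (p122622) region theorems.
[cite: BockleHui2025, Theorem 1.1 and Theorem 1.2] [cite: BuzzardGeeLMS2014, Conj. 3.1.6] -/
theorem irreducibleOffSector_text_of_open_regions_v2
    (h27 : exists_galoisRep_of_regularAlgebraic)
    (hBH : isIrreducible_galoisRep_gl3_totallyReal)
    (hWA : ∀ (K : Type) [Field K] [NumberField K] (h1 : isCompact_glFiniteIntegralLevel 1 K) (ℓ : ℕ) [Fact ℓ.Prime] (n : ℕ) (E : Type) [Field E] [NumberField E] (e : E →+* PadicAlgCl ℓ) (ρ : FramedGaloisRep K (PadicAlgCl ℓ) n), ρ.toGaloisRep.IsSemisimple → (∀ᶠ v in cofinite, ρ.IsUnramifiedAt v ∧ ∃ P : Polynomial E, ρ.HasFrobCharpolyAt v (P.map e)) → ∀ (ψ : FramedGaloisRep K (PadicAlgCl ℓ) 1), (∀ᶠ v in cofinite, ρ.IsUnramifiedAt v ∧ ψ.IsUnramifiedAt v ∧ ∀ 𝔓 ∈ v.primesAbove, ∀ σ : Field.absoluteGaloisGroup K, IsArithFrobAt (𝓞 K)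 σ 𝔓 → ψ.charpoly σ ∣ ρ.charpoly σ) → ∀ (ι : PadicAlgCl ℓ ≃+* ℂ), ∃ χ : CuspidalAutomorphicRepData 1 K h1, χ.1.IsRegularAlgebraic ∧ ∀ᶠ v in cofinite, ∃ c : ℂ, χ.1.HasSatakeParamAt v {c} ∧ ψ.IsUnramifiedAt v ∧ ψ.HasFrobCharpolyAt v (arithFrobPolyOfSatake ι v.residueCard 1 {c}))
    (hHE : Clozel1990_heckeEigenvalueField)
    (h22 : JacquetShalika1981_partialPairL_boundary_repData)
    -- the conjecture: Buzzard–Gee 3.1.6 for L-algebraic cuspidal `GL_2` (unramified places)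
    (hLA2 : ∀ (K : Type) [Field K] [NumberField K] (hcpt : isCompact_glFiniteIntegralLevel 2 K)
      (π : CuspidalAutomorphicRepData 2 K hcpt), π.1.IsLAlgebraic →
        ∃ E : Subfield ℂ, FiniteDimensional ℚ E ∧
          ∀ᶠ v in cofinite, ∀ α : Multiset ℂ, π.1.HasSatakeParamAt v α →
            ∀ i ≤ 2, α.esymm i ∈ E)
    -- residual open region: rank 3, irregular `π`, not of Galois type, not monomial
    (H3irr' : ∀ (K : Type) [Field K] [NumberField K] (hcpt : isCompact_glFiniteIntegralLevel 3 K)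
      (π : CuspidalAutomorphicRepData 3 K hcpt), π.1.IsLAlgebraic →
        (¬ ∃ T : InfinityType K 3, π.1.HasInfinityType T ∧ T.IsRegular) →
        (¬ ∃ σ : FramedArtinRep K 3, σ.toGaloisRep.IsIrreducible ∧ IsPiOfArtinRep σ π.1) →
        (¬ ∃ (E : Type) (_ : Field E) (_ : NumberField E) (_ : Algebra K E) (_ : IsGalois K E)
            (h1 : isCompact_glFiniteIntegralLevel 1 E) (τ : AutomorphicRepData (AutomorphyDatum.gl 1 E h1)),
            τ.IsLAlgebraic ∧ IsAutomorphicInductionAlong τ π.1 ∧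
            ∀ g : E ≃ₐ[K] E, g ≠ 1 →
              ¬ ∀ᶠ w : HeightOneSpectrum (𝓞 E) in cofinite, ∀ α : Multiset ℂ,
                  τ.HasSatakeParamAt w α → τ.HasSatakeParamAt (g • w) α) →
          ∀ (ℓ : ℕ) [Fact ℓ.Prime] (ι : PadicAlgCl ℓ ≃+* ℂ) (ρ : FramedGaloisRep K (PadicAlgCl ℓ) 3),
            (∀ᶠ v in cofinite, SatakeFrobCompatibleAt ι π.1 ρ v) →
              ρ.toGaloisRep.IsIrreducible)
    -- residual open region: rank 3, `K` neither TR nor CM, `π` regular ess. self-dual, not Galois type, not monomial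
    (H3esd' : ∀ (K : Type) [Field K] [NumberField K], ¬ IsTotallyReal K → ¬ IsCMField K →
      ∀ (h1 : isCompact_glFiniteIntegralLevel 1 K) (hcpt : isCompact_glFiniteIntegralLevel 3 K)
        (π : CuspidalAutomorphicRepData 3 K hcpt), π.1.IsLAlgebraic →
          (∃ T : InfinityType K 3, π.1.HasInfinityType T ∧ T.IsRegular) →
            (∃ η : CuspidalAutomorphicRepData 1 K h1, ∀ᶠ v in cofinite,
              ∀ α : Multiset ℂ, π.1.HasSatakeParamAt v α →
                ∃ c : ℂ, η.1.HasSatakeParamAt v {c} ∧ α.map (fun a => a⁻¹) = α.map (fun a => c * a)) →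
            (¬ ∃ σ : FramedArtinRep K 3, σ.toGaloisRep.IsIrreducible ∧ IsPiOfArtinRep σ π.1) →
            (¬ ∃ (E : Type) (_ : Field E) (_ : NumberField E) (_ : Algebra K E) (_ : IsGalois K E)
                (h1 : isCompact_glFiniteIntegralLevel 1 E)
                (τ : AutomorphicRepData (AutomorphyDatum.gl 1 E h1)),
                τ.IsLAlgebraic ∧ IsAutomorphicInductionAlong τ π.1 ∧
                ∀ g : E ≃ₐ[K] E, g ≠ 1 →
                  ¬ ∀ᶠ w : HeightOneSpectrum (𝓞 E) in cofinite, ∀ α : Multiset ℂ,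
                      τ.HasSatakeParamAt w α → τ.HasSatakeParamAt (g • w) α) →
              ∀ (ℓ : ℕ) [Fact ℓ.Prime] (ι : PadicAlgCl ℓ ≃+* ℂ) (ρ : FramedGaloisRep K (PadicAlgCl ℓ) 3),
                (∀ᶠ v in cofinite, SatakeFrobCompatibleAt ι π.1 ρ v) →
                  ρ.toGaloisRep.IsIrreducible)
    -- open region: rank `≥ 4`, `K` totally real or CM: irreducibility of the attached representation (as v1)
    (H4att : ∀ (n : ℕ), 4 ≤ n → ∀ (K : Type) [Field K] [NumberField K], (IsTotallyReal K ∨ IsCMField K) →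
      ∀ (hcpt : isCompact_glFiniteIntegralLevel n K) (π' : CuspidalAutomorphicRepData n K hcpt),
        π'.1.IsRegularAlgebraic →
          ∀ (ℓ : ℕ) [Fact ℓ.Prime] (ι : PadicAlgCl ℓ ≃+* ℂ) (r : FramedGaloisRep K (PadicAlgCl ℓ) n),
            r.toGaloisRep.IsSemisimple →
              (∀ (v : HeightOneSpectrum (𝓞 K)) (β : Multiset ℂ), π'.1.HasSatakeParamAt v β →
                ((ℓ : ℕ) : 𝓞 K) ∉ v.asIdeal →
                  r.IsUnramifiedAt v ∧ r.HasFrobCharpolyAt v (arithFrobPolyOfSatake ι v.residueCard n β)) →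
              r.toGaloisRep.IsIrreducible)
    -- residual open region: rank `≥ 4`, `π` irregular or `K` neither TR nor CM, not Galois type, not monomial
    (H4rest' : ∀ (n : ℕ), 4 ≤ n → ∀ (K : Type) [Field K] [NumberField K]
      (hcpt : isCompact_glFiniteIntegralLevel n K) (π : CuspidalAutomorphicRepData n K hcpt),
        π.1.IsLAlgebraic →
          ¬ ((IsTotallyReal K ∨ IsCMField K) ∧ ∃ T : InfinityType K n, π.1.HasInfinityType T ∧ T.IsRegular) →
          (¬ ∃ σ : FramedArtinRep K n, σ.toGaloisRep.IsIrreducible ∧ IsPiOfArtinRep σ π.1) →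
          (¬ ∃ (E : Type) (_ : Field E) (_ : NumberField E) (_ : Algebra K E) (_ : IsGalois K E)
              (h1 : isCompact_glFiniteIntegralLevel 1 E)
              (τ : AutomorphicRepData (AutomorphyDatum.gl 1 E h1)),
              τ.IsLAlgebraic ∧ IsAutomorphicInductionAlong τ π.1 ∧
              ∀ g : E ≃ₐ[K] E, g ≠ 1 →
                ¬ ∀ᶠ w : HeightOneSpectrum (𝓞 E) in cofinite, ∀ α : Multiset ℂ,
                    τ.HasSatakeParamAt w α → τ.HasSatakeParamAt (g • w) α) →
            ∀ (ℓ : ℕ) [Fact ℓ.Prime] (ι : PadicAlgCl ℓ ≃+* ℂ) (ρ : FramedGaloisRep K (PadicAlgCl ℓ) n),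
              (∀ᶠ v in cofinite, SatakeFrobCompatibleAt ι π.1 ρ v) → ρ.toGaloisRep.IsIrreducible) :
    ∀ (n : ℕ) (K : Type) [Field K] [NumberField K] (hcpt : isCompact_glFiniteIntegralLevel n K), 0 < n → ∀ (π : CuspidalAutomorphicRepData n K hcpt), π.1.IsLAlgebraic → ¬ (n = 3 ∧ IsCMField K ∧ ∃ T : InfinityType K n, π.1.HasInfinityType T ∧ T.IsRegular) → ∀ (ℓ : ℕ) [Fact ℓ.Prime] (ι : PadicAlgCl ℓ ≃+* ℂ) (ρ : FramedGaloisRep K (PadicAlgCl ℓ) n), (∀ᶠ v : HeightOneSpectrum (𝓞 K) in cofinite, SatakeFrobCompatibleAt ι π.1 ρ v) → ρ.toGaloisRep.IsIrreducible :=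
  irreducibleOffSector_text_of_open_regions h27 hBH hWA hHE h22 hLA2
    (fun K _ _ hcpt π hL hirr ℓ _ ι ρ hρ =>
      conclusion_of_not_galoisType_not_monomial π ι
        (fun hG hM => H3irr' K hcpt π hL hirr hG hM ℓ ι) ρ hρ)
    (fun K _ _ hTR hCM h1 hcpt π hL hreg hesd ℓ _ ι ρ hρ =>
      conclusion_of_not_galoisType_not_monomial π ι
        (fun hG hM => H3esd' K hTR hCM h1 hcpt π hL hreg hesd hG hM ℓ ι) ρ hρ)
    H4att
    (fun n h4 K _ _ hcpt π hL hc ℓ _ ι ρ hρ =>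
      conclusion_of_not_galoisType_not_monomial π ι
        (fun hG hM => H4rest' n h4 K hcpt π hL hc hG hM ℓ ι) ρ hρ)

end Summit.Langlands.Langlands.Theorems.IrreducibleOffSector

end
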